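import Literature.NumberTheory.LFunctions.ConreyVHalfIntegerEdge
import Literature.NumberTheory.LFunctions.ConreyVDiscGrowth
import Literature.NumberTheory.LFunctions.LittlewoodLemma
import HarnessLib

/-!
# Levinson's method, the Littlewood step: `2π(½ − a) N_V ≤ ½U log(mean square of ψV) + O(U + log T)`

Topic `Literature/NumberTheory/LFunctions`. Everything here is PROVED; there are no definitions
and no named facts.

Conrey, J. Number Theory 16 (1983), §4 (4) (Levinson 1974, §§2–3; Titchmarsh §10.28
(10.28.8)–(10.28.11)): the number `N_V` of zeros of `V = conreyV 𝜙 L` in the zero-detection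
rectangle `(½, 5/2) × (T₁, T₂)` is bounded through Littlewood's lemma applied to the *mollified*
function `ψV` on a rectangle `[a, b] × [T₁, T₂]`, `a < ½`, and the arithmetic–geometric mean
inequality:

  `2π(½ − a) N_V ≤ ½ U log(U⁻¹ ∫_{T₁}^{T₂} |ψV(a+it)|² dt) + O(U) + O(log T₂ + log B_ψ)`,

`U = T₂ − T₁`, `B_ψ` a bound for `ψ` near the corners. Here `ψ` is ANY entire function which is
close to `1` on the right edge (`|ψ(b+it) − 1| ≤ θ_ψ`, `b = m + ½` a half-integer `≥ 9/2`) — for a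
Dirichlet polynomial `ψ(s) = 1 + Σ_{n≥2} aₙ n^{−s}` this is the choice of `b` — and the zeros of
`V` are among those of `ψV` (with multiplicity). The right edge costs `−U log((1−θ)|𝜙(0)|)` with
`θ → 0` as `b → ∞`; the horizontal edges and the argument on the right edge cost
`O(log T₂ + log B_ψ)`.

* `untop₀_meromorphicOrderAt_eq_toNat`, `untop₀_meromorphicOrderAt_le_mul` —
  `m_V(ρ) ≤ m_{ψV}(ρ)` for analytic `ψ ≢ 0`, `V`;
* `re_ofReal_mul_pos_of_norm_sub_le`, `norm_ge_of_norm_sub_le'` — `‖w − c‖ ≤ θ|c|`, `θ < 1` ⇒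
  `Re(c w) > 0`, `‖w‖ ≥ (1−θ)|c|`;
* `levinson_littlewood_bound` — **the bound above**, from
  `Literature.NumberTheory.LFunctions.littlewood_count_le_of_meanSquare` (Littlewood + AM–GM),
  Backlund's lemma for `ψV` on the discs `|z − (b + iTᵢ)| ≤ b`
  (`Literature.NumberTheory.LFunctions.norm_conreyV_le_of_mem_closedBall_radius`), and the right
  edge `‖V(b+it) − 𝜙(0)‖ ≤ (1/(m−½) + η)|𝜙(0)|`
  (`Literature.NumberTheory.LFunctions.conreyV_halfInteger_edge`, `m ≥ 4`).

What remains of Levinson's method after this file and `LevinsonConreyInequality.lean` is the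
asymptotic evaluation of the mollified mean square `∫ |ψV(a+it)|² dt` (PRZZ 2020, Thms 1.3, 4.1, 7.1)
and the numerical value of its main term.

## References

* J. B. Conrey, *Zeros of derivatives of Riemann's ξ-function on the critical line*, J. Number
  Theory 16 (1983), 49–74, §4 (4). [Conrey1983]
* E. C. Titchmarsh, *The Theory of the Riemann Zeta-Function*, 2nd ed. (1986), §9.9, §10.28.
  [Titchmarsh1986]
* K. Pratt, N. Robles, A. Zaharescu, D. Zeindler, Res. Math. Sci. 7 (2020), §1.3.
  [PrattRoblesZaharescuZeindler2020]
-/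

noncomputable section

open Complex Polynomial Set Filter Topology Metric MeasureTheory intervalIntegral
open scoped Real ComplexConjugate

namespace Literature.NumberTheory.LFunctions

open Literature.Analysis.Complex SiegelIntegral

/-! ### Multiplicities of `V` versus `ψV` -/

/-- For `f` analytic at `z`, the integer multiplicity `(meromorphicOrderAt f z).untop₀` is the
natural number `(analyticOrderAt f z).toNat`. [folklore] -/
theorem untop₀_meromorphicOrderAt_eq_toNat {f : ℂ → ℂ} {z : ℂ} (hf : AnalyticAt ℂ f z) :
    (meromorphicOrderAt f z).untop₀ = ((analyticOrderAt f z).toNat : ℤ) := by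
  rw [hf.meromorphicOrderAt_eq]
  cases analyticOrderAt f z with
  | top => simp
  | coe n => simp

/-- For `ψ`, `V` analytic at `z` with `ψ ≢ 0` near `z`: `m_V(z) ≤ m_{ψV}(z)` (as real numbers,
`m = (meromorphicOrderAt · z).untop₀`). [folklore] -/
theorem untop₀_meromorphicOrderAt_le_mul {ψ V : ℂ → ℂ} {z : ℂ} (hψ : AnalyticAt ℂ ψ z)
    (hV : AnalyticAt ℂ V z) (hψz : analyticOrderAt ψ z ≠ ⊤) :
    ((meromorphicOrderAt V z).untop₀ : ℝ) ≤ (meromorphicOrderAt (fun w ↦ ψ w * V w) z).untop₀ := by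
  have hmul : (fun w ↦ ψ w * V w) = ψ * V := rfl
  rw [hmul, untop₀_meromorphicOrderAt_eq_toNat hV, untop₀_meromorphicOrderAt_eq_toNat (hψ.mul hV),
    analyticOrderAt_mul hψ hV]
  have key : (analyticOrderAt V z).toNat ≤ (analyticOrderAt ψ z + analyticOrderAt V z).toNat := by
    by_cases hVt : analyticOrderAt V z = ⊤
    · simp [hVt]
    · rw [ENat.toNat_add hψz hVt]; exact Nat.le_add_left _ _
  exact_mod_cast key

/-- The multiplicity of an analytic function is `≥ 0` (as a real number). [folklore] -/
theorem untop₀_meromorphicOrderAt_nonneg_real {f : ℂ → ℂ} {z : ℂ} (hf : AnalyticAt ℂ f z) :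
    (0 : ℝ) ≤ ((meromorphicOrderAt f z).untop₀ : ℝ) := by
  rw [untop₀_meromorphicOrderAt_eq_toNat hf]
  exact_mod_cast Nat.zero_le _

/-! ### `‖w − c‖ ≤ θ|c|` with `θ < 1` -/

/-- If `‖w − c‖ ≤ θ|c|` (`c ≠ 0` real, `θ < 1`) then `Re(c·w) > 0`. [folklore] -/
theorem re_ofReal_mul_pos_of_norm_sub_le {c θ : ℝ} {w : ℂ} (hc : c ≠ 0) (hθ : θ < 1)
    (h : ‖w - c‖ ≤ θ * |c|) : 0 < ((c : ℂ) * w).re := by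
  have hc2 : 0 < c ^ 2 := lt_of_le_of_ne (sq_nonneg c) (Ne.symm (pow_ne_zero 2 hc))
  have hre : |(w - c).re| ≤ θ * |c| := (Complex.abs_re_le_norm _).trans h
  rw [sub_re, ofReal_re] at hre
  have h1 : ((c : ℂ) * w).re = c * w.re := by simp
  rw [h1]
  have h2 : c * w.re = c ^ 2 + c * (w.re - c) := by ring
  rw [h2]
  have h3 : |c * (w.re - c)| ≤ θ * c ^ 2 := by
    rw [abs_mul]
    calc |c| * |w.re - c| ≤ |c| * (θ * |c|) := mul_le_mul_of_nonneg_left hre (abs_nonneg _)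
      _ = θ * c ^ 2 := by rw [← sq_abs]; ring
  nlinarith [neg_abs_le (c * (w.re - c))]

/-- If `‖w − c‖ ≤ θ|c|` then `‖w‖ ≥ (1 − θ)|c|`. [folklore] -/
theorem norm_ge_of_norm_sub_le' {c θ : ℝ} {w : ℂ} (h : ‖w - c‖ ≤ θ * |c|) :
    (1 - θ) * |c| ≤ ‖w‖ := by
  have h1 : ‖(c : ℂ)‖ ≤ ‖w‖ + ‖w - c‖ := by
    calc ‖(c : ℂ)‖ = ‖w - (w - c)‖ := by rw [sub_sub_cancel]
      _ ≤ ‖w‖ + ‖w - c‖ := norm_sub_le _ _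
  rw [Complex.norm_real, Real.norm_eq_abs] at h1
  nlinarith

/-! ### The Littlewood step -/

/-- **Levinson's method, the Littlewood step** (Conrey 1983, §4 (4)). Let `𝜙` be a real polynomial
with `𝜙(0) ≠ 0`, `m ≥ 4`, `b = m + ½`. There are `L₀ ≥ 1`, `T₀ > 0`, `C > 0` such that for all
`L ≥ L₀`, `⅛ ≤ a < ½`, `T₀ ≤ T₁ < T₂`, every entire `ψ` with `‖ψ‖ ≤ B_ψ` (`B_ψ ≥ 1`) on the discs
`|z − (b + iTᵢ)| ≤ b` and `‖ψ(b+it) − 1‖ ≤ θ_ψ` for `t ∈ [T₁, T₂]`, and such that `ψV`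
(`V = conreyV 𝜙 L`) has no zero on the bottom, top and left edges of `[a, b] × [T₁, T₂]`:
`2π(½ − a) Σ_{V(ρ)=0, ρ ∈ (½,5/2)×(T₁,T₂)} m_V(ρ)`
`≤ ½(T₂−T₁) log((T₂−T₁)⁻¹ ∫_{T₁}^{T₂} ‖ψV(a+iy)‖² dy) − (T₂−T₁) log((1−θ)|𝜙(0)|) + C (log T₂ + log B_ψ)`,
`θ = θ_V + θ_ψ + θ_Vθ_ψ ≤ ½`, `θ_V = 1/(m−½) + η` (`η > 0` arbitrary): the right-edge loss
`−log(1 − θ)` per unit height tends to `0` as `m → ∞`, `η, θ_ψ → 0` (for `𝜙(0) = 1`).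
[cite: Conrey1983, §4 (4)] -/
theorem levinson_littlewood_bound (φ : ℝ[X]) (hφ : φ.coeff 0 ≠ 0) {m : ℕ} (hm : 4 ≤ m)
    {η θψ : ℝ} (hη : 0 < η) (hθψ : 0 ≤ θψ)
    (hθ : 1 / ((m : ℝ) - 1 / 2) + η + θψ + (1 / ((m : ℝ) - 1 / 2) + η) * θψ ≤ 1 / 2) :
    ∃ L₀ T₀ C : ℝ, 1 ≤ L₀ ∧ 0 < T₀ ∧ 0 < C ∧
      ∀ L : ℝ, L₀ ≤ L → ∀ a T₁ T₂ : ℝ, 1 / 8 ≤ a → a < 1 / 2 → T₀ ≤ T₁ → T₁ < T₂ →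
      ∀ (ψ : ℂ → ℂ) (Bψ : ℝ), Differentiable ℂ ψ → 1 ≤ Bψ →
        (∀ z ∈ closedBall ((((m : ℝ) + 1 / 2 : ℝ) : ℂ) + T₁ * I) ((m : ℝ) + 1 / 2) ∪
            closedBall ((((m : ℝ) + 1 / 2 : ℝ) : ℂ) + T₂ * I) ((m : ℝ) + 1 / 2), ‖ψ z‖ ≤ Bψ) →
        (∀ y ∈ Icc T₁ T₂, ‖ψ ((((m : ℝ) + 1 / 2 : ℝ) : ℂ) + y * I) - 1‖ ≤ θψ) →
        (∀ x ∈ Icc a ((m : ℝ) + 1 / 2), ψ (x + T₁ * I) * conreyV φ L (x + T₁ * I) ≠ 0) →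
        (∀ x ∈ Icc a ((m : ℝ) + 1 / 2), ψ (x + T₂ * I) * conreyV φ L (x + T₂ * I) ≠ 0) →
        (∀ y ∈ Icc T₁ T₂, ψ (a + y * I) * conreyV φ L (a + y * I) ≠ 0) →
        2 * π * (1 / 2 - a) *
            ∑ᶠ ρ ∈ {ρ : ℂ | conreyV φ L ρ = 0 ∧ ρ ∈ Ioo (1 / 2 : ℝ) (5 / 2) ×ℂ Ioo T₁ T₂},
              ((meromorphicOrderAt (conreyV φ L) ρ).untop₀ : ℝ) ≤
          (T₂ - T₁) / 2 * Real.log ((T₂ - T₁)⁻¹ *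
              ∫ y in T₁..T₂, ‖ψ (a + y * I) * conreyV φ L (a + y * I)‖ ^ 2) +
            (T₂ - T₁) * (-Real.log ((1 - (1 / ((m : ℝ) - 1 / 2) + η + θψ +
              (1 / ((m : ℝ) - 1 / 2) + η) * θψ)) * |φ.coeff 0|)) +
            C * (Real.log T₂ + Real.log Bψ) := by
  have hπ := Real.pi_pos
  have hπ3 := Real.pi_gt_three
  have hm' : (4 : ℝ) ≤ m := by exact_mod_cast hm
  set b : ℝ := (m : ℝ) + 1 / 2 with hb
  have hb4 : 9 / 2 ≤ b := by rw [hb]; linarith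
  set θV : ℝ := 1 / ((m : ℝ) - 1 / 2) + η with hθV
  set θ : ℝ := θV + θψ + θV * θψ with hθdef
  have hθV0 : 0 < θV := by
    rw [hθV]; have : 0 < (m : ℝ) - 1 / 2 := by linarith
    positivity
  have hθ0 : 0 < θ := by rw [hθdef]; positivity
  have hθ1 : θ ≤ 1 / 2 := hθ
  -- `V` on the right edge `σ = b`
  obtain ⟨L₀, U₀, hL₀, hU₀, hVedge⟩ :=
    conreyV_halfInteger_edge φ hφ (le_trans (by norm_num) hm) (η := η) hη
  set c₀ : ℝ := φ.coeff 0 with hc₀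
  have hc₀0 : 0 < |c₀| := abs_pos.2 hφ
  have h1θ : |c₀| / 2 ≤ (1 - θ) * |c₀| := by nlinarith only [hθ1, hc₀0]
  -- the disc constant for `V`
  set ψφ : ℝ[X] := φ.comp (1 - X) with hψφ
  set CV : ℝ := ((∑ k ∈ φ.support, |φ.coeff k| * (k.factorial : ℝ)) * (6 * (4 : ℝ) ^ (2 * b + 1)) +
    30 * (2 * π) ^ (2 * b) * (∑ k ∈ ψφ.support, |ψφ.coeff k| * (k.factorial : ℝ)) *
      (6 * (4 : ℝ) ^ (2 * b))) + 1 with hCV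
  have hA₀0 : 0 ≤ ∑ k ∈ φ.support, |φ.coeff k| * (k.factorial : ℝ) :=
    Finset.sum_nonneg fun k _ ↦ by positivity
  have hA₂0 : 0 ≤ ∑ k ∈ ψφ.support, |ψφ.coeff k| * (k.factorial : ℝ) :=
    Finset.sum_nonneg fun k _ ↦ by positivity
  have h41 : (0 : ℝ) ≤ 6 * (4 : ℝ) ^ (2 * b + 1) := by positivity
  have h40 : (0 : ℝ) ≤ 6 * (4 : ℝ) ^ (2 * b) := by positivity
  have h30 : (0 : ℝ) ≤ 30 * (2 * π) ^ (2 * b) := by positivity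
  have hCV1 : 1 ≤ CV := by
    rw [hCV]
    have h1 := mul_nonneg hA₀0 h41
    have h2 := mul_nonneg (mul_nonneg h30 hA₂0) h40
    linarith
  clear_value CV
  have hCVpos : 0 < CV := by linarith
  -- Backlund constants
  set ℓ : ℝ := Real.log (b / (b - 1 / 8)) with hℓ
  have hℓ0 : 0 < ℓ := by
    rw [hℓ]; refine Real.log_pos ?_
    rw [lt_div_iff₀ (by linarith)]; linarith
  set K : ℝ := Real.log CV + (b + 2) + |Real.log (|c₀| / 2)| with hK
  have hK0 : 0 ≤ K := by
    rw [hK]; have := Real.log_nonneg hCV1; positivity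
  set CB : ℝ := π * ((K + 1) / ℓ + 1) with hCB
  have hCB0 : 0 < CB := by rw [hCB]; positivity
  set C : ℝ := b * π + 2 * b * CB with hC
  have hCpos : 0 < C := by rw [hC]; positivity
  clear_value K CB C
  -- thresholds
  set T₀ : ℝ := max U₀ (max (2 * π * (8 * b + 8) ^ 2 + 128 * π + b + 2) 3) with hT₀
  refine ⟨L₀, T₀, C, hL₀, lt_of_lt_of_le hU₀ (le_max_left _ _), hCpos,
    fun L hL a T₁ T₂ ha ha2 hT₁ hT₁₂ ψ Bψ hψd hBψ hψB hψ1 h_bot h_top h_left ↦ ?_⟩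
  have hU₀T₁ : U₀ ≤ T₁ := le_trans (le_max_left _ _) hT₁
  have hDT₁ : 2 * π * (8 * b + 8) ^ 2 + 128 * π + b + 2 ≤ T₁ :=
    le_trans (le_trans (le_max_left _ _) (le_max_right _ _)) hT₁
  have h3T₁ : 3 ≤ T₁ := le_trans (le_trans (le_max_right _ _) (le_max_right _ _)) hT₁
  have hsq : 0 ≤ 2 * π * (8 * b + 8) ^ 2 := by positivity
  have hbT₁ : b + 2 ≤ T₁ := by linarith only [hDT₁, hsq, hπ]
  have hT₁0 : 0 < T₁ := by linarith only [h3T₁]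
  have hL1 : 1 ≤ L := le_trans hL₀ hL
  have hab : a < b := by linarith only [ha2, hb4]
  have hlogT₂ : 1 ≤ Real.log T₂ := by
    rw [← Real.log_exp 1]
    refine Real.log_le_log (Real.exp_pos 1) ?_
    have := Real.exp_one_lt_d9
    linarith only [this, h3T₁, hT₁₂]
  have hlogBψ : 0 ≤ Real.log Bψ := Real.log_nonneg hBψ
  set V : ℂ → ℂ := conreyV φ L with hVdef
  set f : ℂ → ℂ := fun z ↦ ψ z * V z with hfdef
  -- analyticity
  have hfa : ∀ z : ℂ, z.im ≠ 0 → AnalyticAt ℂ f z := fun z hz ↦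
    (hψd.analyticAt z).mul (analyticAt_conreyV_of_im_ne_zero φ L hz)
  have hfrect : AnalyticOnNhd ℂ f (Icc a b ×ℂ Icc T₁ T₂) := by
    intro z hz
    refine hfa z ?_
    have := (Complex.mem_reProdIm.1 hz).2.1
    intro h0; rw [h0] at this; linarith only [this, hT₁0]
  -- the right edge: `‖f(b+iy) - c₀‖ ≤ θ|c₀|`
  have hedge : ∀ y ∈ Icc T₁ T₂, ‖f ((b : ℂ) + y * I) - c₀‖ ≤ θ * |c₀| := by
    intro y hy
    have hV2 : ‖V ((b : ℂ) + y * I) - c₀‖ ≤ θV * |c₀| := hVedge L hL y (le_trans hU₀T₁ hy.1)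
    have hψy := hψ1 y hy
    have hψn : ‖ψ ((b : ℂ) + y * I)‖ ≤ 1 + θψ := by
      calc ‖ψ ((b : ℂ) + y * I)‖ = ‖(ψ ((b : ℂ) + y * I) - 1) + 1‖ := by rw [sub_add_cancel]
        _ ≤ ‖ψ ((b : ℂ) + y * I) - 1‖ + ‖(1 : ℂ)‖ := norm_add_le _ _
        _ ≤ θψ + 1 := by rw [norm_one]; linarith only [hψy]
        _ = 1 + θψ := by ring
    have e : f ((b : ℂ) + y * I) - c₀ =
        ψ ((b : ℂ) + y * I) * (V ((b : ℂ) + y * I) - c₀) + (ψ ((b : ℂ) + y * I) - 1) * c₀ := by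
      simp only [hfdef]; ring
    rw [e]
    calc ‖ψ ((b : ℂ) + y * I) * (V ((b : ℂ) + y * I) - c₀) + (ψ ((b : ℂ) + y * I) - 1) * c₀‖
        ≤ ‖ψ ((b : ℂ) + y * I)‖ * ‖V ((b : ℂ) + y * I) - c₀‖ + ‖ψ ((b : ℂ) + y * I) - 1‖ * ‖(c₀ : ℂ)‖ := by
          refine (norm_add_le _ _).trans ?_
          rw [norm_mul, norm_mul]
      _ ≤ (1 + θψ) * (θV * |c₀|) + θψ * |c₀| := by
          rw [Complex.norm_real, Real.norm_eq_abs]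
          gcongr
      _ = θ * |c₀| := by rw [hθdef]; ring
  have hre_edge : ∀ y ∈ Icc T₁ T₂, 0 < ((c₀ : ℂ) * f ((b : ℂ) + y * I)).re := fun y hy ↦
    re_ofReal_mul_pos_of_norm_sub_le hφ (by linarith only [hθ1]) (hedge y hy)
  have hnorm_edge : ∀ y ∈ Icc T₁ T₂, (1 - θ) * |c₀| ≤ ‖f ((b : ℂ) + y * I)‖ := fun y hy ↦
    norm_ge_of_norm_sub_le' (hedge y hy)
  have hnorm_edge' : ∀ y ∈ Icc T₁ T₂, |c₀| / 2 ≤ ‖f ((b : ℂ) + y * I)‖ := fun y hy ↦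
    h1θ.trans (hnorm_edge y hy)
  have h_right : ∀ y ∈ Icc T₁ T₂, f ((b : ℂ) + y * I) ≠ 0 := by
    intro y hy h0
    have := hnorm_edge' y hy
    rw [h0, norm_zero] at this
    linarith only [this, hc₀0]
  -- `ψ ≢ 0`
  have hψne : ψ ≠ 0 := by
    intro h0
    have := hnorm_edge' T₁ ⟨le_rfl, hT₁₂.le⟩
    simp only [hfdef, h0, Pi.zero_apply, zero_mul, norm_zero] at this
    linarith only [this, hc₀0]
  -- Backlund on the horizontal edges
  have hBack : ∀ T : ℝ, T₁ ≤ T → T ≤ T₂ →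
      (∀ z ∈ closedBall ((b : ℂ) + T * I) b, ‖ψ z‖ ≤ Bψ) →
      (∀ x ∈ Icc a b, f (x + T * I) ≠ 0) →
      ∀ σ ∈ Icc a b, |(∫ x : ℝ in σ..b, deriv f (x + T * I) / f (x + T * I)).im| ≤
        CB * (Real.log T₂ + Real.log Bψ) := by
    intro T hT1 hT2 hψT h0T σ hσ
    have hT0 : 0 < T := by linarith only [hT₁0, hT1]
    have hT3 : 3 ≤ T := by linarith only [h3T₁, hT1]
    have hlogT : 1 ≤ Real.log T := by
      rw [← Real.log_exp 1]
      refine Real.log_le_log (Real.exp_pos 1) ?_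
      have := Real.exp_one_lt_d9
      linarith only [this, hT3]
    have hlogT' : Real.log T ≤ Real.log T₂ := Real.log_le_log hT0 hT2
    set M : ℝ := Bψ * (CV * T ^ (b + 2)) with hM
    have hTb : 1 ≤ T ^ (b + 2) := Real.one_le_rpow (by linarith only [hT3]) (by linarith only [hb4])
    have hTbpos : 0 < T ^ (b + 2) := by linarith only [hTb]
    have hM1 : 1 ≤ M := by
      rw [hM]
      calc (1 : ℝ) = 1 * (1 * 1) := by ring
        _ ≤ Bψ * (CV * T ^ (b + 2)) := by gcongr
    have hMpos : 0 < M := by linarith only [hM1]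
    have hBψ0 : 0 < Bψ := by linarith only [hBψ]
    have hc2 : 0 < |c₀| / 2 := by linarith only [hc₀0]
    have hb1 : 1 ≤ b := by linarith only [hb4]
    have hTD : 2 * π * (8 * b + 8) ^ 2 + 128 * π + b + 2 ≤ T := by linarith only [hDT₁, hT1]
    have hsup : ∀ z ∈ closedBall ((b : ℂ) + T * I) b, ‖f z‖ ≤ M := by
      intro z hz
      have hVz := norm_conreyV_le_of_mem_closedBall_radius φ hb1 hL1 hTD hz
      simp only [hfdef, norm_mul, hM]
      refine mul_le_mul (hψT z hz) (hVz.trans ?_) (norm_nonneg _) hBψ0.le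
      refine mul_le_mul_of_nonneg_right ?_ hTbpos.le
      rw [hCV]; linarith only
    have han : ∀ z ∈ closedBall ((b : ℂ) + T * I) b, AnalyticAt ℂ f z := by
      intro z hz
      refine hfa z ?_
      rw [mem_closedBall_iff_norm] at hz
      have him := Complex.abs_im_le_norm (z - ((b : ℂ) + T * I))
      simp only [sub_im, add_im, ofReal_im, mul_im, ofReal_re, I_im, mul_one, I_re, mul_zero,
        add_zero, zero_add] at him
      have := (abs_le.1 (him.trans hz)).1
      intro h0; rw [h0] at this; linarith only [this, hT1, hbT₁]
    have hcentre := hnorm_edge' T ⟨hT1, hT2⟩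
    have hc : f ((b : ℂ) + T * I) ≠ 0 := h_right T ⟨hT1, hT2⟩
    have hB := abs_im_integral_logDeriv_le_backlund (g := f) (c := b) (y := T) (r := b - 1 / 8)
      (R := b) (M := M) (a := σ) (b := b) (by linarith only [hb4]) (by linarith only [hb4]) hM1 han hsup
      hc hσ.2 (by linarith only [hσ.1, ha]) (by linarith only [hb4])
      (fun x hx ↦ h0T x ⟨le_trans hσ.1 hx.1, hx.2⟩)
    refine hB.trans ?_
    have hfpos : 0 < ‖f ((b : ℂ) + T * I)‖ := lt_of_lt_of_le hc2 hcentre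
    have hlogM : Real.log (M / ‖f ((b : ℂ) + T * I)‖) ≤ Real.log Bψ + K * Real.log T₂ := by
      have h1 : M / ‖f ((b : ℂ) + T * I)‖ ≤ M / (|c₀| / 2) :=
        div_le_div_of_nonneg_left hMpos.le hc2 hcentre
      calc Real.log (M / ‖f ((b : ℂ) + T * I)‖) ≤ Real.log (M / (|c₀| / 2)) :=
            Real.log_le_log (div_pos hMpos hfpos) h1
        _ = Real.log Bψ + Real.log CV + (b + 2) * Real.log T - Real.log (|c₀| / 2) := by
            rw [Real.log_div hMpos.ne' hc2.ne', hM, Real.log_mul hBψ0.ne' (mul_pos hCVpos hTbpos).ne',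
              Real.log_mul hCVpos.ne' hTbpos.ne', Real.log_rpow hT0]
            ring
        _ ≤ Real.log Bψ + Real.log CV + (b + 2) * Real.log T + |Real.log (|c₀| / 2)| := by
            linarith only [neg_abs_le (Real.log (|c₀| / 2))]
        _ ≤ Real.log Bψ + K * Real.log T₂ := by
            rw [hK]
            have h2 : 0 ≤ Real.log CV := Real.log_nonneg hCV1
            have h3 : 0 ≤ |Real.log (|c₀| / 2)| := abs_nonneg _
            have e1 : Real.log CV ≤ Real.log CV * Real.log T₂ := le_mul_of_one_le_right h2 hlogT₂
            have e2 : (b + 2) * Real.log T ≤ (b + 2) * Real.log T₂ :=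
              mul_le_mul_of_nonneg_left hlogT' (by linarith only [hb4])
            have e3 : |Real.log (|c₀| / 2)| ≤ |Real.log (|c₀| / 2)| * Real.log T₂ :=
              le_mul_of_one_le_right h3 hlogT₂
            linarith only [e1, e2, e3]
    have hquot : Real.log (M / ‖f ((b : ℂ) + T * I)‖) / Real.log (b / (b - 1 / 8)) + 1 ≤
        ((K + 1) / ℓ + 1) * (Real.log T₂ + Real.log Bψ) := by
      have h1 : Real.log (M / ‖f ((b : ℂ) + T * I)‖) / ℓ ≤ (Real.log Bψ + K * Real.log T₂) / ℓ :=
        div_le_div_of_nonneg_right hlogM hℓ0.le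
      have h2 : Real.log Bψ + K * Real.log T₂ ≤ (K + 1) * (Real.log T₂ + Real.log Bψ) := by
        nlinarith only [hK0, hlogBψ, hlogT₂]
      have h3 : (Real.log Bψ + K * Real.log T₂) / ℓ ≤ (K + 1) / ℓ * (Real.log T₂ + Real.log Bψ) := by
        rw [div_mul_eq_mul_div]; exact div_le_div_of_nonneg_right h2 hℓ0.le
      have h4 : (1 : ℝ) ≤ Real.log T₂ + Real.log Bψ := by linarith only [hlogT₂, hlogBψ]
      rw [← hℓ]
      have e : ((K + 1) / ℓ + 1) * (Real.log T₂ + Real.log Bψ) =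
          (K + 1) / ℓ * (Real.log T₂ + Real.log Bψ) + (Real.log T₂ + Real.log Bψ) := by ring
      rw [e]
      linarith only [h1, h3, h4]
    rw [hCB, mul_assoc]
    exact mul_le_mul_of_nonneg_left hquot hπ.le
  have hψB₁ : ∀ z ∈ closedBall ((b : ℂ) + T₁ * I) b, ‖ψ z‖ ≤ Bψ := fun z hz ↦ hψB z (Or.inl hz)
  have hψB₂ : ∀ z ∈ closedBall ((b : ℂ) + T₂ * I) b, ‖ψ z‖ ≤ Bψ := fun z hz ↦ hψB z (Or.inr hz)
  have hBc := hBack T₁ le_rfl hT₁₂.le hψB₁ h_bot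
  have hBd := hBack T₂ hT₁₂.le le_rfl hψB₂ h_top
  -- Littlewood + AM–GM
  have hLW := littlewood_count_le_of_meanSquare (f := f) hab hT₁₂ hfrect h_bot h_top h_left h_right
    (1 / 2) hBc hBd
  -- the zeros of `V` are among those of `f` with `Re ≥ 1/2`
  set SV : Set ℂ := {ρ : ℂ | V ρ = 0 ∧ ρ ∈ Ioo (1 / 2 : ℝ) (5 / 2) ×ℂ Ioo T₁ T₂} with hSV
  set Sf : Set ℂ := {ρ : ℂ | f ρ = 0 ∧ ρ ∈ Ioo a b ×ℂ Ioo T₁ T₂ ∧ (1 / 2 : ℝ) ≤ ρ.re} with hSf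
  have hsub : SV ⊆ Sf := by
    rintro ρ ⟨hρ0, hρ⟩
    obtain ⟨⟨h1, h2⟩, h3⟩ := Complex.mem_reProdIm.1 hρ
    refine ⟨by simp only [hfdef, hρ0, mul_zero], Complex.mem_reProdIm.2 ⟨⟨by linarith, by linarith⟩, h3⟩,
      h1.le⟩
  have hSf_fin : Sf.Finite := by
    have hcorner : ((b : ℂ) + T₁ * I) ∈ Icc a b ×ℂ Icc T₁ T₂ :=
      Complex.mem_reProdIm.2 ⟨by simpa using hab.le, by simpa using hT₁₂.le⟩
    exact (finite_zeros_reProdIm hab.le hT₁₂.le hfrect hcorner (h_right T₁ ⟨le_rfl, hT₁₂.le⟩)).subset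
      (fun ρ hρ ↦ ⟨hρ.1, hρ.2.1⟩)
  have hSV_fin : SV.Finite := hSf_fin.subset hsub
  have hcmp : ∑ᶠ ρ ∈ SV, ((meromorphicOrderAt V ρ).untop₀ : ℝ) ≤
      ∑ᶠ ρ ∈ Sf, ((meromorphicOrderAt f ρ).untop₀ : ℝ) := by
    rw [finsum_mem_eq_finite_toFinset_sum _ hSV_fin, finsum_mem_eq_finite_toFinset_sum _ hSf_fin]
    have him : ∀ ρ ∈ Sf, ρ.im ≠ 0 := by
      rintro ρ ⟨_, hρ, _⟩ h0
      have := (Complex.mem_reProdIm.1 hρ).2.1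
      rw [h0] at this; linarith only [this, hT₁0]
    calc ∑ ρ ∈ hSV_fin.toFinset, ((meromorphicOrderAt V ρ).untop₀ : ℝ)
        ≤ ∑ ρ ∈ hSV_fin.toFinset, ((meromorphicOrderAt f ρ).untop₀ : ℝ) := by
          refine Finset.sum_le_sum fun ρ hρ ↦ ?_
          have hρ' : ρ ∈ Sf := hsub ((Set.Finite.mem_toFinset hSV_fin).1 hρ)
          have hψρ : analyticOrderAt ψ ρ ≠ ⊤ := by
            rw [Ne, AnalyticOnNhd.analyticOrderAt_eq_top_iff_eq_zero ρ (fun z ↦ hψd.analyticAt z)]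
            exact hψne
          exact untop₀_meromorphicOrderAt_le_mul (hψd.analyticAt ρ)
            (analyticAt_conreyV_of_im_ne_zero φ L (him ρ hρ')) hψρ
      _ ≤ ∑ ρ ∈ hSf_fin.toFinset, ((meromorphicOrderAt f ρ).untop₀ : ℝ) := by
          refine Finset.sum_le_sum_of_subset_of_nonneg ?_ fun ρ hρ _ ↦ ?_
          · intro ρ hρ
            rw [Set.Finite.mem_toFinset] at hρ ⊢
            exact hsub hρ
          · exact untop₀_meromorphicOrderAt_nonneg_real
              (hfa ρ (him ρ ((Set.Finite.mem_toFinset hSf_fin).1 hρ)))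
  -- the right-edge integrals
  have hf_right_an : ∀ y ∈ Icc T₁ T₂, AnalyticAt ℂ f ((b : ℂ) + y * I) := fun y hy ↦
    hfrect _ (Complex.mem_reProdIm.2 ⟨by simpa using hab.le, by simpa using hy⟩)
  have hlog : (T₂ - T₁) * Real.log ((1 - θ) * |c₀|) ≤ ∫ y in T₁..T₂, Real.log ‖f ((b : ℂ) + y * I)‖ := by
    have hconst : ∫ _ in T₁..T₂, Real.log ((1 - θ) * |c₀|) = (T₂ - T₁) * Real.log ((1 - θ) * |c₀|) := by
      rw [intervalIntegral.integral_const, smul_eq_mul]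
    rw [← hconst]
    refine intervalIntegral.integral_mono_on hT₁₂.le (by simp)
      ((continuousOn_log_norm_vertical hf_right_an h_right).intervalIntegrable_of_Icc hT₁₂.le)
      fun y hy ↦ ?_
    have hpos : 0 < (1 - θ) * |c₀| := mul_pos (by linarith only [hθ1]) hc₀0
    exact Real.log_le_log hpos (hnorm_edge y hy)
  have harg : |∫ y in T₁..T₂, (deriv f ((b : ℂ) + y * I) / f ((b : ℂ) + y * I)).re| ≤ π := by
    have hc0 : (c₀ : ℂ) ≠ 0 := by exact_mod_cast hφ
    set g : ℂ → ℂ := fun z ↦ (c₀ : ℂ) * f z with hg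
    have hga : ∀ y ∈ Icc T₁ T₂, AnalyticAt ℂ g ((b : ℂ) + y * I) := fun y hy ↦
      analyticAt_const.mul (hf_right_an y hy)
    have hg0 : ∀ y ∈ Icc T₁ T₂, g ((b : ℂ) + y * I) ≠ 0 := by
      intro y hy h0
      have := hre_edge y hy
      have h0' : (c₀ : ℂ) * f ((b : ℂ) + y * I) = 0 := h0
      rw [h0', zero_re] at this
      exact lt_irrefl 0 this
    have hmain := abs_integral_re_logDeriv_vertical_le_pi_of_re_nonneg (g := g) b hT₁₂.le hga hg0
      (fun y hy ↦ (hre_edge y hy).le)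
    have e : (fun y : ℝ ↦ (deriv g ((b : ℂ) + y * I) / g ((b : ℂ) + y * I)).re) =
        fun y : ℝ ↦ (deriv f ((b : ℂ) + y * I) / f ((b : ℂ) + y * I)).re := by
      funext y
      simp only [hg]
      rw [deriv_const_mul_div_self (c₀ : ℂ) hc0]
    rwa [e] at hmain
  -- assemble
  have hba : b - a ≤ b := by linarith only [ha]
  have hba0 : 0 ≤ b - a := by linarith only [hab]
  have h1 : -(∫ y in T₁..T₂, Real.log ‖f ((b : ℂ) + y * I)‖) ≤
      (T₂ - T₁) * (-Real.log ((1 - θ) * |c₀|)) := by linarith only [hlog]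
  have h2 : (b - a) * (∫ y in T₁..T₂, (deriv f ((b : ℂ) + y * I) / f ((b : ℂ) + y * I)).re) ≤ b * π := by
    have i1 := (le_abs_self (∫ y in T₁..T₂, (deriv f ((b : ℂ) + y * I) / f ((b : ℂ) + y * I)).re)).trans harg
    calc (b - a) * (∫ y in T₁..T₂, (deriv f ((b : ℂ) + y * I) / f ((b : ℂ) + y * I)).re)
        ≤ (b - a) * π := mul_le_mul_of_nonneg_left i1 hba0
      _ ≤ b * π := mul_le_mul_of_nonneg_right hba hπ.le
  have hS0 : 0 ≤ CB * (Real.log T₂ + Real.log Bψ) := mul_nonneg hCB0.le (by linarith only [hlogT₂, hlogBψ])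
  have h3 : (b - a) * (CB * (Real.log T₂ + Real.log Bψ) + CB * (Real.log T₂ + Real.log Bψ)) ≤
      2 * b * CB * (Real.log T₂ + Real.log Bψ) := by
    have e : (b - a) * (CB * (Real.log T₂ + Real.log Bψ) + CB * (Real.log T₂ + Real.log Bψ)) =
        2 * ((b - a) * (CB * (Real.log T₂ + Real.log Bψ))) := by ring
    rw [e]
    have i2 : (b - a) * (CB * (Real.log T₂ + Real.log Bψ)) ≤ b * (CB * (Real.log T₂ + Real.log Bψ)) :=
      mul_le_mul_of_nonneg_right hba hS0
    linarith only [i2]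
  have h4 : b * π + 2 * b * CB * (Real.log T₂ + Real.log Bψ) ≤ C * (Real.log T₂ + Real.log Bψ) := by
    rw [hC]
    have hbπ : 0 ≤ b * π := mul_nonneg (by linarith only [hb4]) hπ.le
    have hS1 : (1 : ℝ) ≤ Real.log T₂ + Real.log Bψ := by linarith only [hlogT₂, hlogBψ]
    have e : (b * π + 2 * b * CB) * (Real.log T₂ + Real.log Bψ) =
        b * π * (Real.log T₂ + Real.log Bψ) + 2 * b * CB * (Real.log T₂ + Real.log Bψ) := by ring
    rw [e]
    have i3 : b * π ≤ b * π * (Real.log T₂ + Real.log Bψ) := le_mul_of_one_le_right hbπ hS1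
    linarith only [i3]
  have hπa : 0 ≤ 2 * π * (1 / 2 - a) := mul_nonneg (by linarith only [hπ]) (by linarith only [ha2])
  calc 2 * π * (1 / 2 - a) * ∑ᶠ ρ ∈ SV, ((meromorphicOrderAt V ρ).untop₀ : ℝ)
      ≤ 2 * π * (1 / 2 - a) * ∑ᶠ ρ ∈ Sf, ((meromorphicOrderAt f ρ).untop₀ : ℝ) :=
        mul_le_mul_of_nonneg_left hcmp hπa
    _ ≤ (T₂ - T₁) / 2 * Real.log ((T₂ - T₁)⁻¹ * ∫ y in T₁..T₂, ‖f (a + y * I)‖ ^ 2) -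
          (∫ y in T₁..T₂, Real.log ‖f ((b : ℂ) + y * I)‖) +
          (b - a) * (∫ y in T₁..T₂, (deriv f ((b : ℂ) + y * I) / f ((b : ℂ) + y * I)).re) +
          (b - a) * (CB * (Real.log T₂ + Real.log Bψ) + CB * (Real.log T₂ + Real.log Bψ)) := hLW
    _ ≤ (T₂ - T₁) / 2 * Real.log ((T₂ - T₁)⁻¹ * ∫ y in T₁..T₂, ‖f (a + y * I)‖ ^ 2) +
          (T₂ - T₁) * (-Real.log ((1 - θ) * |c₀|)) + C * (Real.log T₂ + Real.log Bψ) := by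
        linarith only [h1, h2, h3, h4]

end Literature.NumberTheory.LFunctions

end
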